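import Literature.Topology.FourManifolds.SliceKnots
import Literature.Topology.FourManifolds.KnotGroupAbelianization
import Literature.Topology.FourManifolds.KnotGroupMulEquivProofs
import HarnessLib

/-!
# Fox–Milnor: the algebraic half of `Δ(t) ≐ f(t) f(t⁻¹)` for slice knots

Sibling proof file of `Literature/Topology/FourManifolds/SliceKnots.lean`, home of the proof
programme for the named facts
`Literature.Topology.FourManifolds.exists_eq_mul_invert_of_isTopologicallySlice` and
`Literature.Topology.FourManifolds.exists_eq_mul_invert_of_isSmoothlySlice` (Fox–Milnor (1966),
Thm. 2: an Alexander polynomial of a (topologically, resp. smoothly) slice knot has the form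
`u · f(t) · f(t⁻¹)`).

## The printed proof and what is proved here

The proof in print (Kauffman, *On Knots* (1987), Ch. VIII, Thm. 8.2–8.3; Livingston, *A survey of
classical knot concordance* (2005), Thm. 2.6 and §3.3, with §6 for the locally flat category) has
a geometric and an algebraic half.

* *Geometric half* (not in the tree): a Seifert surface `F` of `K` with Seifert matrix `V`
  presents the Alexander module `G'/G''` of the knot group by the square matrix `V − tVᵀ`
  (Rolfsen (1976), §8.C), and if `K` bounds a flat disc `D ⊆ B⁴` then `V` is **metabolic**
  (Livingston, Def. 2.5 and Thm. 2.6: `F ∪ D` bounds a `3`-manifold `R ⊆ B⁴`, half of `H₁(F)` dies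
  in `H₁(R)` by duality, and the Seifert form vanishes on that half), i.e. congruent over `ℤ` to a
  block matrix `(0 A; B D)` with square blocks of equal size.
* *Algebraic half* (this file, fully proved): for a metabolic `V`,
  `det (V − tVᵀ) = u · f(t) · f(t⁻¹)` with `f = det (A − tBᵀ)` and a unit `u` of `ℤ[t, t⁻¹]`
  (Livingston §3.3; Kauffman Thm. 8.3 (ii)), and the passage from this determinant to *every*
  Alexander polynomial of `K` in the sense of `Knot.IsAlexanderPolynomial` (base-point
  independence `IsAlexanderPolynomial.of_mulEquiv_holds`; the two isomorphisms `Gᵃᵇ ≃* ℤ` differ by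
  `t ↦ t⁻¹`; generators of the same principal ideal of the domain `ℤ[t, t⁻¹]` differ by a unit).

Main statements:

* `Literature.Topology.FourManifolds.FoxMilnor.exists_det_fromBlocks_sub_T_smul_transpose_eq` —
  the block determinant identity over any commutative ring;
* `Literature.Topology.FourManifolds.FoxMilnor.exists_det_sub_T_smul_transpose_eq_of_metabolic` —
  the same for a matrix congruent (by a matrix of unit determinant) and reindexed to block form;
* `Literature.Topology.FourManifolds.Knot.exists_eq_mul_invert_of_metabolic_presentation` — if the
  Alexander module of `π₁(S³ ∖ K, x)` has a square presentation whose matrix, pushed to `ℤ[t, t⁻¹]`,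
  is `V − tVᵀ` for a metabolic integer matrix `V`, then every Alexander polynomial `Δ` of `K` is
  `u · f · f(t⁻¹)`;
* `Literature.Topology.FourManifolds.exists_eq_mul_invert_of_isTopologicallySlice_of_presentation`,
  `Literature.Topology.FourManifolds.exists_eq_mul_invert_of_isSmoothlySlice_of_presentation` — the
  two named facts of `SliceKnots.lean` follow from the geometric half, stated as an explicit
  hypothesis (it is NOT vendored as a named fact).

## References

* R. H. Fox, J. W. Milnor, *Singularities of 2-spheres in 4-space and cobordism of knots*, Osaka
  J. Math. 3 (1966), 257–267, Thm. 2. [FoxMilnor1966]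
* L. H. Kauffman, *On Knots*, Ann. of Math. Studies 115 (1987), Ch. VIII, Thm. 8.2, Thm. 8.3
  (pp. 229–230). [Kauffman1987]
* C. Livingston, *A survey of classical knot concordance*, Handbook of Knot Theory (2005), Def. 2.5,
  Thm. 2.6, §3.3, §6 (arXiv math/0307077). [Livingston2005]
* D. Rolfsen, *Knots and Links* (1976), §8.C. [Rolfsen1976]

## Design notes

* No statement of another file is modified; no definition and no named fact (`def … : Prop`) is
  introduced (theorems only, D-0026); no `sorry`.
* The matrix lemmas are stated for matrices over `R[t, t⁻¹]`, with "matrix of constants"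
  expressed as `A.map invert = A` (satisfied by `V.map C`, `FoxMilnor.map_C_map_invert`); the
  integer data of the knot-level statements is pushed to `ℤ[t, t⁻¹]` by `C : ℤ →+* ℤ[t, t⁻¹]`.
  We use `V − tVᵀ` (Livingston's convention `Δ_V(t) = det (V − tVᵀ)`); the other printed
  conventions (`tV − Vᵀ`, `Vᵀ − tV`) differ from it by transposition and units and lead to the same
  conclusion.
-/

open scoped LaurentPolynomial
open Function Set Matrix LaurentPolynomial

noncomputable section

namespace Literature.Topology.FourManifolds

namespace FoxMilnor

/-! ## Algebra in `R[t, t⁻¹]` -/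

section Algebra

variable {R : Type*} [CommRing R]

/-- `(u · f · f(t⁻¹))(t⁻¹)` is again of the form `u' · f' · f'(t⁻¹)` (with `f' = f(t⁻¹)`).
[folklore] -/
theorem exists_invert_eq_mul_invert (f : R[T;T⁻¹]) (u : R[T;T⁻¹]ˣ) :
    ∃ (f' : R[T;T⁻¹]) (u' : R[T;T⁻¹]ˣ),
      invert ((u : R[T;T⁻¹]) * f * invert f) = (u' : R[T;T⁻¹]) * f' * invert f' := by
  refine ⟨invert f, Units.map (invert (R := R) : R[T;T⁻¹] ≃ₐ[R] R[T;T⁻¹]) u, ?_⟩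
  rw [map_mul, map_mul, involutive_invert f, Units.coe_map]
  rfl

/-- Generators of the same principal ideal of a domain differ by a unit: if `(Δ) = (u · f · f(t⁻¹))`
then `Δ = u' · f · f(t⁻¹)`. [folklore] -/
theorem exists_eq_mul_invert_of_span_eq [IsDomain R[T;T⁻¹]] {Δ d f : R[T;T⁻¹]} {u : R[T;T⁻¹]ˣ}
    (h : Ideal.span {Δ} = Ideal.span {d}) (hd : d = (u : R[T;T⁻¹]) * f * invert f) :
    ∃ (f' : R[T;T⁻¹]) (u' : R[T;T⁻¹]ˣ), Δ = (u' : R[T;T⁻¹]) * f' * invert f' := by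
  obtain ⟨v, hv⟩ := Ideal.span_singleton_eq_span_singleton.mp h
  refine ⟨f, v⁻¹ * u, ?_⟩
  rw [Units.val_mul]
  linear_combination (↑v⁻¹ : R[T;T⁻¹]) * hv + (↑v⁻¹ : R[T;T⁻¹]) * hd - Δ * Units.mul_inv v

/-- Congruence commutes with `M ↦ M − c Mᵀ`: `QᵀVQ − c (QᵀVQ)ᵀ = Qᵀ (V − c Vᵀ) Q`. [folklore] -/
theorem transpose_mul_mul_sub_smul_transpose {S : Type*} [CommRing S] {n : Type*} [Fintype n]
    (c : S) (V Q : Matrix n n S) : Qᵀ * V * Q - c • (Qᵀ * V * Q)ᵀ = Qᵀ * (V - c • Vᵀ) * Q := by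
  simp only [transpose_mul, transpose_transpose, Matrix.mul_sub, Matrix.sub_mul, Matrix.mul_smul,
    Matrix.smul_mul, Matrix.mul_assoc]

/-- Reindexing commutes with `M ↦ M − c Mᵀ`. [folklore] -/
theorem reindex_sub_smul_transpose {S : Type*} [CommRing S] {n n' : Type*} (c : S) (e : n ≃ n')
    (V : Matrix n n S) : reindex e e V - c • (reindex e e V)ᵀ = reindex e e (V - c • Vᵀ) :=
  rfl

/-- If the entries of `A` and `B` are constants (fixed by `t ↦ t⁻¹`), then `t ↦ t⁻¹` applied
entrywise turns `A − t Bᵀ` into `A − t⁻¹ Bᵀ`. [folklore] -/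
theorem map_invert_sub_T_smul_transpose {m : Type*} {A B : Matrix m m R[T;T⁻¹]}
    (hA : A.map invert = A) (hB : B.map invert = B) :
    (A - (T 1 : R[T;T⁻¹]) • Bᵀ).map invert = A - (T (-1) : R[T;T⁻¹]) • Bᵀ := by
  ext i j : 1
  have ha : invert (A i j) = A i j := congrFun (congrFun hA i) j
  have hb : invert (B j i) = B j i := congrFun (congrFun hB j) i
  simp only [Matrix.map_apply, Matrix.sub_apply, Matrix.smul_apply, Matrix.transpose_apply,
    smul_eq_mul, map_sub, map_mul, invert_T, ha, hb]

/-- `det (B − t Aᵀ) = (−t)^m · (det (A − t Bᵀ))(t⁻¹)` for matrices of constants: transpose, pull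
out `−t`, and apply `t ↦ t⁻¹` (Kauffman (1987), proof of Thm. 8.3 (ii)).
[cite: Kauffman1987, Ch. VIII Thm. 8.3] -/
theorem det_sub_T_smul_transpose_swap {m : Type*} [Fintype m] [DecidableEq m]
    {A B : Matrix m m R[T;T⁻¹]} (hA : A.map invert = A) (hB : B.map invert = B) :
    (B - (T 1 : R[T;T⁻¹]) • Aᵀ).det =
      (-T 1 : R[T;T⁻¹]) ^ Fintype.card m * invert (A - (T 1 : R[T;T⁻¹]) • Bᵀ).det := by
  have hT : (T 1 : R[T;T⁻¹]) * T (-1) = 1 := by rw [← T_add]; simp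
  have key : ∀ a b : R[T;T⁻¹], b - T 1 * a = -T 1 * (a - T (-1) * b) := fun a b ↦ by
    linear_combination (-b) * hT
  have h1 : B - (T 1 : R[T;T⁻¹]) • Aᵀ =
      ((-T 1 : R[T;T⁻¹]) • (A - (T (-1) : R[T;T⁻¹]) • Bᵀ))ᵀ := by
    ext i j : 1
    simp only [Matrix.sub_apply, Matrix.smul_apply, Matrix.transpose_apply, smul_eq_mul]
    exact key _ _
  rw [h1, det_transpose, det_smul, AlgEquiv.map_det, AlgEquiv.mapMatrix_apply,
    map_invert_sub_T_smul_transpose hA hB]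

/-- **The block determinant behind `Δ ≐ f f̄`** (Livingston (2005), §3.3 "if `V` is metabolic then
`Δ_V(t) = ± tⁿ f(t) f(t⁻¹)`"; Kauffman (1987), Thm. 8.3 (ii)). For `W = (0 A; B D)` with square
blocks, `A` and `B` matrices of constants, `det (W − tWᵀ) = u · f · f(t⁻¹)` in `R[t, t⁻¹]` with
`f = det (A − tBᵀ)` and `u` a unit (`±(−t)^m`): `W − tWᵀ = (0, A − tBᵀ; B − tAᵀ, D − tDᵀ)`, swapping
the block columns makes it block triangular, and `det (B − tAᵀ) = (−t)^m f(t⁻¹)`.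
[cite: Livingston2005, §3.3] -/
theorem exists_det_fromBlocks_sub_T_smul_transpose_eq {m : Type*} [Fintype m] [DecidableEq m]
    {A B : Matrix m m R[T;T⁻¹]} (hA : A.map invert = A) (hB : B.map invert = B)
    (D : Matrix m m R[T;T⁻¹]) :
    ∃ u : R[T;T⁻¹]ˣ, (fromBlocks 0 A B D - (T 1 : R[T;T⁻¹]) • (fromBlocks 0 A B D)ᵀ).det =
      (u : R[T;T⁻¹]) * (A - (T 1 : R[T;T⁻¹]) • Bᵀ).det *
        invert (A - (T 1 : R[T;T⁻¹]) • Bᵀ).det := by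
  -- `W − tWᵀ` as a block matrix
  have hN : fromBlocks 0 A B D - (T 1 : R[T;T⁻¹]) • (fromBlocks 0 A B D)ᵀ =
      fromBlocks 0 (A - (T 1 : R[T;T⁻¹]) • Bᵀ) (B - (T 1 : R[T;T⁻¹]) • Aᵀ)
        (D - (T 1 : R[T;T⁻¹]) • Dᵀ) := by
    ext (i | i) (j | j) : 1 <;>
      simp [Matrix.sub_apply, Matrix.smul_apply, Matrix.transpose_apply]
  -- swapping the block columns makes it block lower triangular
  have hswap : (fromBlocks 0 A B D - (T 1 : R[T;T⁻¹]) • (fromBlocks 0 A B D)ᵀ).submatrix id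
      (Equiv.sumComm m m) = fromBlocks (A - (T 1 : R[T;T⁻¹]) • Bᵀ) 0 (D - (T 1 : R[T;T⁻¹]) • Dᵀ)
        (B - (T 1 : R[T;T⁻¹]) • Aᵀ) := by
    rw [hN]
    change (fromBlocks _ _ _ _).submatrix id Sum.swap = _
    rw [fromBlocks_submatrix_sum_swap_right, submatrix_id_id]
  have hdet : ((Equiv.Perm.sign (Equiv.sumComm m m) : ℤ) : R[T;T⁻¹]) *
      (fromBlocks 0 A B D - (T 1 : R[T;T⁻¹]) • (fromBlocks 0 A B D)ᵀ).det =
      (A - (T 1 : R[T;T⁻¹]) • Bᵀ).det * (B - (T 1 : R[T;T⁻¹]) • Aᵀ).det := by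
    rw [← det_permute', hswap, det_fromBlocks_zero₁₂]
  -- the sign and `(-t)^m` are units
  obtain ⟨ε, hε⟩ : IsUnit (((Equiv.Perm.sign (Equiv.sumComm m m)) : ℤ) : R[T;T⁻¹]) :=
    (Equiv.Perm.sign (Equiv.sumComm m m)).isUnit.map (Int.castRingHom R[T;T⁻¹])
  obtain ⟨τ, hτ⟩ : IsUnit ((-T 1 : R[T;T⁻¹]) ^ Fintype.card m) :=
    ((isUnit_T (R := R) 1).neg).pow _
  refine ⟨ε⁻¹ * τ, ?_⟩
  rw [det_sub_T_smul_transpose_swap hA hB, ← hτ, ← hε] at hdet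
  rw [Units.val_mul]
  linear_combination (↑ε⁻¹ : R[T;T⁻¹]) * hdet -
    (fromBlocks 0 A B D - (T 1 : R[T;T⁻¹]) • (fromBlocks 0 A B D)ᵀ).det * Units.inv_mul ε

/-- **`Δ_V ≐ f f̄` for metabolic `V`** (Livingston (2005), Def. 2.5 and §3.3; Kauffman (1987),
Thm. 8.3 (ii)). If the square matrix `V` over `R[t, t⁻¹]` is *metabolic* — congruent by a matrix
`Q` of unit determinant, after reindexing, to a block matrix `(0 A; B D)` with square blocks of
equal size, `A` and `B` matrices of constants — then `det (V − tVᵀ) = u · f · f(t⁻¹)` for some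
`f ∈ R[t, t⁻¹]` and a unit `u`. [cite: Livingston2005, §3.3] -/
theorem exists_det_sub_T_smul_transpose_eq_of_metabolic {n : Type*} [Fintype n] [DecidableEq n]
    {m : Type*} [Fintype m] [DecidableEq m] (V Q : Matrix n n R[T;T⁻¹]) (hQ : IsUnit Q.det)
    (e : m ⊕ m ≃ n) {A B : Matrix m m R[T;T⁻¹]} (hA : A.map invert = A) (hB : B.map invert = B)
    (D : Matrix m m R[T;T⁻¹]) (hV : Qᵀ * V * Q = reindex e e (fromBlocks 0 A B D)) :
    ∃ (f : R[T;T⁻¹]) (u : R[T;T⁻¹]ˣ),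
      (V - (T 1 : R[T;T⁻¹]) • Vᵀ).det = (u : R[T;T⁻¹]) * f * invert f := by
  obtain ⟨u, hu⟩ := exists_det_fromBlocks_sub_T_smul_transpose_eq hA hB D
  obtain ⟨q, hq⟩ := hQ
  -- congruence multiplies the determinant by `(det Q)²`, reindexing does not change it
  have key : (Qᵀ * (V - (T 1 : R[T;T⁻¹]) • Vᵀ) * Q).det = (u : R[T;T⁻¹]) *
      (A - (T 1 : R[T;T⁻¹]) • Bᵀ).det * invert (A - (T 1 : R[T;T⁻¹]) • Bᵀ).det := by
    rw [← transpose_mul_mul_sub_smul_transpose, hV, reindex_sub_smul_transpose, det_reindex_self,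
      hu]
  rw [det_mul, det_mul, det_transpose, ← hq] at key
  refine ⟨(A - (T 1 : R[T;T⁻¹]) • Bᵀ).det, q⁻¹ * q⁻¹ * u, ?_⟩
  rw [Units.val_mul, Units.val_mul]
  linear_combination (↑q⁻¹ * ↑q⁻¹ : R[T;T⁻¹]) * key -
    ((↑q⁻¹ : R[T;T⁻¹]) * ↑q + 1) * (V - (T 1 : R[T;T⁻¹]) • Vᵀ).det * Units.inv_mul q

/-- A matrix of constants is fixed by `t ↦ t⁻¹` applied entrywise. [folklore] -/
theorem map_C_map_invert {m n : Type*} (A : Matrix m n R) :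
    (A.map (C : R →+* R[T;T⁻¹])).map invert = A.map (C : R →+* R[T;T⁻¹]) := by
  rw [Matrix.map_map, invert_comp_C]

end Algebra

/-! ## The two isomorphisms `H ≃* ℤ` -/

/-- Two isomorphisms of a group onto `ℤ` agree up to inversion (`Aut ℤ = {±1}`). [folklore] -/
theorem mulEquiv_eq_or_eq_trans_inv {H : Type*} [Group H]
    (e e' : H ≃* Multiplicative ℤ) : e' = e ∨ e' = e.trans (MulEquiv.inv (Multiplicative ℤ)) := by
  -- `e⁻¹ ≫ e'` is `n ↦ n * a` with `a` the image of `1`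
  have hpow : ∀ n : ℤ, e' (e.symm (Multiplicative.ofAdd n)) =
      Multiplicative.ofAdd (n * (e' (e.symm (Multiplicative.ofAdd 1))).toAdd) := fun n ↦ by
    have h1 : Multiplicative.ofAdd n = (Multiplicative.ofAdd (1 : ℤ)) ^ n := by
      rw [← ofAdd_zsmul, smul_eq_mul, mul_one]
    conv_lhs => rw [h1, map_zpow, map_zpow]
    rw [← smul_eq_mul, ofAdd_zsmul, ofAdd_toAdd]
  set a : ℤ := (e' (e.symm (Multiplicative.ofAdd 1))).toAdd with ha
  -- `a = ±1` since `e⁻¹ ≫ e'` is onto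
  obtain ⟨y, hy⟩ : ∃ y : ℤ, e' (e.symm (Multiplicative.ofAdd y)) = Multiplicative.ofAdd 1 :=
    ⟨(e (e'.symm (Multiplicative.ofAdd 1))).toAdd, by
      rw [ofAdd_toAdd, MulEquiv.symm_apply_apply, MulEquiv.apply_symm_apply]⟩
  have hy' : y * a = 1 := Multiplicative.ofAdd.injective ((hpow y).symm.trans hy)
  rcases Int.eq_one_or_neg_one_of_mul_eq_one' hy' with ⟨-, h1⟩ | ⟨-, h1⟩
  · left
    apply MulEquiv.ext
    intro h
    have hh := hpow (e h).toAdd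
    rw [ofAdd_toAdd, MulEquiv.symm_apply_apply, h1, mul_one, ofAdd_toAdd] at hh
    exact hh
  · right
    apply MulEquiv.ext
    intro h
    have hh := hpow (e h).toAdd
    rw [ofAdd_toAdd, MulEquiv.symm_apply_apply, h1, mul_neg, mul_one, ofAdd_neg, ofAdd_toAdd] at hh
    rw [MulEquiv.trans_apply, MulEquiv.inv_apply]
    exact hh

end FoxMilnor

/-! ## From a metabolic presentation of the Alexander module to every Alexander polynomial -/

namespace Knot

open FoxMilnor

/-- **Fox–Milnor, algebraic half.** Let `K` be a knot, `x` a base point of its complement,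
`e : π₁(S³ ∖ K, x)ᵃᵇ ≃* ℤ`, and suppose the Alexander module of `G = π₁(S³ ∖ K, x)` has a square
presentation (generators `g₁, …, gₙ`, a matrix `P` of relations generating all relations) whose
matrix, pushed to `ℤ[t, t⁻¹]` along `e`, is `V − tVᵀ` for a **metabolic** integer matrix `V`
(congruent by a unimodular `Q`, after reindexing, to `(0 A; B D)` with square blocks of equal
size). Then every Alexander polynomial `Δ` of `K` has the form `Δ = u · f · f(t⁻¹)` with
`f ∈ ℤ[t, t⁻¹]` and `u` a unit. This is the algebraic half of Fox–Milnor (1966), Thm. 2, in the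
form of Livingston (2005), §3.3 / Kauffman (1987), Thm. 8.3 (ii); the geometric half (a slice knot
has such a presentation: a Seifert matrix `V` presents the Alexander module by `V − tVᵀ`, Rolfsen
(1976) §8.C, and is metabolic for a slice knot, Livingston Thm. 2.6) is the hypothesis.
Ambiguities of `Knot.IsAlexanderPolynomial`: the base point is moved by
`IsAlexanderPolynomial.of_mulEquiv_holds`, the identification `Gᵃᵇ ≃* ℤ` is `e` or `e` followed by
inversion (`FoxMilnor.mulEquiv_eq_or_eq_trans_inv`, `laurentEquivOfMulEquiv_trans_inv`), and two
generators of the principal ideal `(Δ)` of the domain `ℤ[t, t⁻¹]` differ by a unit.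
[cite: Livingston2005, §3.3] [cite: FoxMilnor1966, Thm. 2] -/
theorem exists_eq_mul_invert_of_metabolic_presentation (K : Knot) (x : K.complement)
    (e : Abelianization (K.group x) ≃* Multiplicative ℤ) {n : ℕ}
    (g : Fin n → alexanderModule (K.group x))
    (hg : Submodule.span (MonoidAlgebra ℤ (Abelianization (K.group x))) (Set.range g) = ⊤)
    (P : Matrix (Fin n) (Fin n) (MonoidAlgebra ℤ (Abelianization (K.group x))))
    (hP : ∀ t, ∑ l, P t l • g l = 0)
    (hgen : ∀ ρ : Fin n → MonoidAlgebra ℤ (Abelianization (K.group x)), ∑ l, ρ l • g l = 0 →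
      ρ ∈ Submodule.span (MonoidAlgebra ℤ (Abelianization (K.group x))) (Set.range P))
    (V : Matrix (Fin n) (Fin n) ℤ)
    (hPV : P.map (laurentEquivOfMulEquiv (K.group x) e) =
      V.map (C : ℤ →+* ℤ[T;T⁻¹]) - (T 1 : ℤ[T;T⁻¹]) • (V.map (C : ℤ →+* ℤ[T;T⁻¹]))ᵀ)
    {m : Type} [Fintype m] [DecidableEq m] (Q : Matrix (Fin n) (Fin n) ℤ) (hQ : IsUnit Q.det)
    (σ : m ⊕ m ≃ Fin n) (A B D : Matrix m m ℤ) (hV : Qᵀ * V * Q = reindex σ σ (fromBlocks 0 A B D))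
    {Δ : ℤ[T;T⁻¹]} (hΔ : K.IsAlexanderPolynomial Δ) :
    ∃ (f : ℤ[T;T⁻¹]) (u : ℤ[T;T⁻¹]ˣ), Δ = ↑u * f * LaurentPolynomial.invert f := by
  -- push the integer data to `ℤ[t, t⁻¹]`
  have hQ' : IsUnit (Q.map (C : ℤ →+* ℤ[T;T⁻¹])).det := by
    rw [← RingHom.mapMatrix_apply, ← RingHom.map_det]
    exact hQ.map _
  have hV' : (Q.map (C : ℤ →+* ℤ[T;T⁻¹]))ᵀ * V.map (C : ℤ →+* ℤ[T;T⁻¹]) *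
      Q.map (C : ℤ →+* ℤ[T;T⁻¹]) = reindex σ σ (fromBlocks 0 (A.map (C : ℤ →+* ℤ[T;T⁻¹]))
        (B.map (C : ℤ →+* ℤ[T;T⁻¹])) (D.map (C : ℤ →+* ℤ[T;T⁻¹]))) := by
    rw [← transpose_map, ← Matrix.map_mul, ← Matrix.map_mul, hV, reindex_apply, reindex_apply,
      ← submatrix_map, fromBlocks_map, Matrix.map_zero _ (map_zero _)]
  -- the Alexander ideal is `(det P)`, and `det` of the pushed matrix is `u₀ f f̄`
  have hI : alexanderIdeal (K.group x) = Ideal.span {P.det} :=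
    alexanderIdeal_eq_span_det_of_square_presentation (K.group x) g hg P hP hgen
  obtain ⟨f, u₀, hf⟩ := exists_det_sub_T_smul_transpose_eq_of_metabolic _ _ hQ' σ
    (map_C_map_invert A) (map_C_map_invert B) _ hV'
  have hdet : laurentEquivOfMulEquiv (K.group x) e P.det = ↑u₀ * f * invert f := by
    rw [RingEquiv.map_det, RingEquiv.mapMatrix_apply, hPV, hf]
  have hmap : (alexanderIdeal (K.group x)).map (laurentEquivOfMulEquiv (K.group x) e) =
      Ideal.span {↑u₀ * f * invert f} := by
    rw [hI, Ideal.map_span, Set.image_singleton, hdet]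
  -- move the base point of `hΔ` to `x`
  haveI : ComplementFacts := complementFacts_holds
  obtain ⟨x', hx'⟩ := hΔ
  obtain ⟨e', he'⟩ : Literature.Topology.FourManifolds.IsAlexanderPolynomial (K.group x) Δ :=
    IsAlexanderPolynomial.of_mulEquiv_holds hx' (K.groupMulEquiv x' x)
  -- `e'` is `e` or `e` followed by inversion
  rcases mulEquiv_eq_or_eq_trans_inv e e' with rfl | rfl
  · rw [hmap] at he'
    exact exists_eq_mul_invert_of_span_eq he'.symm rfl
  · rw [laurentEquivOfMulEquiv_trans_inv, ← Ideal.map_coe, RingEquiv.coe_ringHom_trans,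
      ← Ideal.map_map, Ideal.map_coe, Ideal.map_coe, hmap, Ideal.map_span,
      Set.image_singleton] at he'
    obtain ⟨f', u', hf'⟩ := exists_invert_eq_mul_invert f u₀
    refine exists_eq_mul_invert_of_span_eq he'.symm (f := f') (u := u') ?_
    rw [← hf']
    rfl

end Knot

/-! ## The named facts of `SliceKnots.lean` from the geometric half -/

/-- **Reduction of the topological Fox–Milnor fact to its geometric half.** If every topologically
slice knot admits, at some base point and for some `e : Gᵃᵇ ≃* ℤ`, a square presentation of the
Alexander module of its group whose matrix pushed to `ℤ[t, t⁻¹]` is `V − tVᵀ` for a metabolic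
integer matrix `V` (Seifert matrix of a Seifert surface, Rolfsen (1976) §8.C; metabolic because the
knot bounds a flat disc, Livingston (2005) Thm. 2.6 with §6 for the locally flat category), then
`exists_eq_mul_invert_of_isTopologicallySlice` holds. The hypothesis is the part of Fox–Milnor's
theorem not yet in the tree; it is an explicit hypothesis here, not a named fact.
[cite: Livingston2005, Thm. 2.6, §3.3, §6] [cite: FoxMilnor1966, Thm. 2] -/
theorem exists_eq_mul_invert_of_isTopologicallySlice_of_presentation
    (h : ∀ K : Knot, K.IsTopologicallySlice →
      ∃ (x : K.complement) (e : Abelianization (K.group x) ≃* Multiplicative ℤ) (n : ℕ)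
        (g : Fin n → alexanderModule (K.group x))
        (P : Matrix (Fin n) (Fin n) (MonoidAlgebra ℤ (Abelianization (K.group x))))
        (V Q : Matrix (Fin n) (Fin n) ℤ) (k : ℕ) (σ : Fin k ⊕ Fin k ≃ Fin n)
        (A B D : Matrix (Fin k) (Fin k) ℤ),
        Submodule.span (MonoidAlgebra ℤ (Abelianization (K.group x))) (Set.range g) = ⊤ ∧
        (∀ t, ∑ l, P t l • g l = 0) ∧
        (∀ ρ : Fin n → MonoidAlgebra ℤ (Abelianization (K.group x)), ∑ l, ρ l • g l = 0 →
          ρ ∈ Submodule.span (MonoidAlgebra ℤ (Abelianization (K.group x))) (Set.range P)) ∧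
        P.map (laurentEquivOfMulEquiv (K.group x) e) =
          V.map (C : ℤ →+* ℤ[T;T⁻¹]) - (T 1 : ℤ[T;T⁻¹]) • (V.map (C : ℤ →+* ℤ[T;T⁻¹]))ᵀ ∧
        IsUnit Q.det ∧ Qᵀ * V * Q = reindex σ σ (fromBlocks 0 A B D)) :
    exists_eq_mul_invert_of_isTopologicallySlice := by
  intro K hK Δ hΔ
  obtain ⟨x, e, n, g, P, V, Q, k, σ, A, B, D, hg, hP, hgen, hPV, hQ, hV⟩ := h K hK
  exact K.exists_eq_mul_invert_of_metabolic_presentation x e g hg P hP hgen V hPV Q hQ σ A B D hV hΔ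

/-- **Reduction of the smooth Fox–Milnor fact to its geometric half** (same statement for smoothly
slice knots; Kauffman (1987), Thm. 8.2–8.3; Livingston (2005), Thm. 2.6 and §3.3).
[cite: Kauffman1987, Ch. VIII Thm. 8.3] [cite: FoxMilnor1966, Thm. 2] -/
theorem exists_eq_mul_invert_of_isSmoothlySlice_of_presentation
    (h : ∀ K : Knot, K.IsSmoothlySlice →
      ∃ (x : K.complement) (e : Abelianization (K.group x) ≃* Multiplicative ℤ) (n : ℕ)
        (g : Fin n → alexanderModule (K.group x))
        (P : Matrix (Fin n) (Fin n) (MonoidAlgebra ℤ (Abelianization (K.group x))))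
        (V Q : Matrix (Fin n) (Fin n) ℤ) (k : ℕ) (σ : Fin k ⊕ Fin k ≃ Fin n)
        (A B D : Matrix (Fin k) (Fin k) ℤ),
        Submodule.span (MonoidAlgebra ℤ (Abelianization (K.group x))) (Set.range g) = ⊤ ∧
        (∀ t, ∑ l, P t l • g l = 0) ∧
        (∀ ρ : Fin n → MonoidAlgebra ℤ (Abelianization (K.group x)), ∑ l, ρ l • g l = 0 →
          ρ ∈ Submodule.span (MonoidAlgebra ℤ (Abelianization (K.group x))) (Set.range P)) ∧
        P.map (laurentEquivOfMulEquiv (K.group x) e) =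
          V.map (C : ℤ →+* ℤ[T;T⁻¹]) - (T 1 : ℤ[T;T⁻¹]) • (V.map (C : ℤ →+* ℤ[T;T⁻¹]))ᵀ ∧
        IsUnit Q.det ∧ Qᵀ * V * Q = reindex σ σ (fromBlocks 0 A B D)) :
    exists_eq_mul_invert_of_isSmoothlySlice := by
  intro K hK Δ hΔ
  obtain ⟨x, e, n, g, P, V, Q, k, σ, A, B, D, hg, hP, hgen, hPV, hQ, hV⟩ := h K hK
  exact K.exists_eq_mul_invert_of_metabolic_presentation x e g hg P hP hgen V hPV Q hQ σ A B D hV hΔ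

end Literature.Topology.FourManifolds
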